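import Literature.Algebra.Homology.OrderedCechSystemAugment
import Mathlib.Algebra.Homology.QuasiIso
import Mathlib.Algebra.Homology.ShortComplex.ModuleCat
import HarnessLib

/-!
# The augmentation `(N ∅)[0] ⟶ Č•(N)` is a quasi-isomorphism when the augmented Čech complex is exact (Stacks 01FG, 0133)

Layer `Literature/Algebra/Homology` (proved lemmas only; 0 `def`, 0 named facts, no instance, no notation; pure homological algebra over
a commutative ring `A`). For a system of `A`-modules `N : Finset κ ⥤ ModuleCat A` on the finite subsets of a linearly ordered `κ`, the
augmentation `sysAugmentHom N : (N ∅)[0] ⟶ Č•(N)` of `Algebra/Homology/OrderedCechSystemAugment` is a QUASI-ISOMORPHISM as soon as the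
augmented ordered Čech complex `0 → N ∅ → Č⁰(N) → Č¹(N) → ⋯` is exact, stated ELEMENTWISE (the form in which gluing arguments supply it):

* **`quasiIso_sysAugmentHom_of_exact`** — from `ε` injective, «every `0`-cocycle is an augmented value» and «`Č•(N)` is exact in every
  degree `n ≥ 1`» (binders, phrased with the differentials `(sysComplex N).d`).

Degree `0` is Mathlib's `ShortComplex.quasiIso_iff_of_zeros` (the source is a one-term complex, the target has nothing in degree `-1`),
transported along `singleObjXSelf`; the other degrees are `quasiIsoAt_iff_exactAt` (`ModuleCat`: `ShortComplex.moduleCat_exact_iff`,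
`ModuleCat.mono_iff_injective`). Library only (cell `pub-hodge-ring2`, count-neutral); proves nothing about any crux, route or conjecture.
Mathlib searched (pin v4.32): `quasiIso_iff`, `quasiIsoAt_iff'`, `quasiIsoAt_iff_exactAt`, `ExactAt.of_isZero`, `exactAt_iff'`,
`isZero_single_obj_X`, `single_obj_d`, `ShortComplex.isoMk`, `exact_and_mono_f_iff_of_iso` (used).

## References

* The Stacks Project, Tag 01FG (ordered Čech complex), Tag 0133 (resolutions and double complexes). [StacksProject]
* U. Görtz, T. Wedhorn, *Algebraic Geometry II* (2023), Lemma 21.65, Def. 21.68 (pp. 179–180). [GortzWedhorn2023]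
* C. A. Weibel, *An introduction to homological algebra* (1994), 2.7.3. [Weibel1994]
-/

universe v u

open CategoryTheory CategoryTheory.Limits HomologicalComplex

set_option backward.isDefEq.respectTransparency false

namespace Literature.Algebra.Homology

namespace OrderedCech

variable {κ : Type} [LinearOrder κ] {A : Type u} [CommRing A] (N : Finset κ ⥤ ModuleCat.{u} A)

/-- `ε ≫ d⁰ = 0` as morphisms of modules. [cite: GortzWedhorn2023, Lemma 21.65 (p. 179)] -/
theorem ofHom_sysAugment_comp_sysD : ModuleCat.ofHom (sysAugment N) ≫ ModuleCat.ofHom (sysD N 0) = 0 := by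
  ext g
  exact sysD_sysAugment N g

/-- **`(N ∅)[0] ⟶ Č•(N)` is a quasi-isomorphism when the augmented ordered Čech complex is exact**: `ε` injective, every `0`-cocycle
an augmented value, and `Č•(N)` exact in degrees `≥ 1` (all elementwise). [cite: StacksProject, Tag 0133] [cite: StacksProject, Tag 01FG]
[cite: GortzWedhorn2023, Lemma 21.65 (p. 179)] -/
theorem quasiIso_sysAugmentHom_of_exact
    (hinj : Function.Injective (sysAugment N))
    (hex₀ : ∀ x : SysCochain N 0, sysD N 0 x = 0 → ∃ g : N.obj ∅, sysAugment N g = x)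
    (hex : ∀ n : ℤ, 1 ≤ n → ∀ x : SysCochain N n, ((sysComplex N).d n (n + 1)).hom x = 0 →
      ∃ y : SysCochain N (n - 1), ((sysComplex N).d (n - 1) n).hom y = x) :
    QuasiIso (sysAugmentHom N) := by
  rw [quasiIso_iff]
  intro n
  by_cases hn : n = 0
  · subst hn
    have hd : (sysComplex N).d (-1) 0 = 0 := (isZero_sysComplex_X_of_neg N (-1) (by norm_num)).eq_of_src _ _
    have hf₁ : ((single (ModuleCat.{u} A) (ComplexShape.up ℤ) 0).obj (N.obj ∅)).d (-1) 0 = 0 :=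
      single_obj_d _ _ _ _ _
    have hg₁ : ((single (ModuleCat.{u} A) (ComplexShape.up ℤ) 0).obj (N.obj ∅)).d 0 (0 + 1) = 0 :=
      single_obj_d _ _ _ _ _
    rw [quasiIsoAt_iff' _ (-1) 0 (0 + 1) (by simp) (by simp), ShortComplex.quasiIso_iff_of_zeros _ hf₁ hg₁ hd]
    -- the short complex `N ∅ → Č⁰(N) → Č¹(N)` is exact with injective first map …
    have hT : (ShortComplex.mk (ModuleCat.ofHom (sysAugment N)) (ModuleCat.ofHom (sysD N 0))
        (ofHom_sysAugment_comp_sysD N)).Exact ∧ Mono (ModuleCat.ofHom (sysAugment N)) := by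
      refine ⟨(ShortComplex.moduleCat_exact_iff _).2 fun x hx => ?_, (ModuleCat.mono_iff_injective _).2 hinj⟩
      obtain ⟨g, hg⟩ := hex₀ x hx
      exact ⟨g, hg⟩
    -- … and isomorphic to the one Mathlib asks about (along `singleObjXSelf`, `sysAugmentHom_f_zero`, `sysComplex_d`)
    refine (ShortComplex.exact_and_mono_f_iff_of_iso ?_).1 hT
    refine ShortComplex.isoMk (singleObjXSelf (ComplexShape.up ℤ) 0 (N.obj ∅)).symm (Iso.refl _) (Iso.refl _) ?_ ?_
    · change (singleObjXSelf (ComplexShape.up ℤ) 0 (N.obj ∅)).inv ≫ (sysAugmentHom N).f 0 = _ ≫ 𝟙 _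
      rw [sysAugmentHom_f_zero, Iso.inv_hom_id_assoc, Category.comp_id]
    · change 𝟙 _ ≫ (sysComplex N).d 0 (0 + 1) = _ ≫ 𝟙 _
      rw [sysComplex_d, Category.id_comp, Category.comp_id]
  · rw [quasiIsoAt_iff_exactAt _ n (ExactAt.of_isZero (isZero_single_obj_X _ _ _ _ hn))]
    rcases lt_or_gt_of_ne hn with hlt | hgt
    · exact ExactAt.of_isZero (isZero_sysComplex_X_of_neg N n hlt)
    · rw [exactAt_iff' _ (n - 1) n (n + 1) (by simp) (by simp), ShortComplex.moduleCat_exact_iff]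
      intro x hx
      obtain ⟨y, hy⟩ := hex n (by omega) x hx
      exact ⟨y, hy⟩

end OrderedCech

end Literature.Algebra.Homology
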